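import Literature.Topology.FourManifolds.KnotFamilyAmbientIsotopy
import Literature.Topology.FourManifolds.BandRebuildCurve
import HarnessLib

/-!
# Planar families in the band: isotoping a knot by moving a planar track

Topic `Literature/Topology/FourManifolds` (trunk T-4MAN). Fact seat
`provefact-Literature.Topology.FourManifolds.Knot.IsConnectedSum.isIsotopic` (Schubert's theorem),
geometric heart for rail knots, closure step. A generic tool: let `b` be band-sum data and `k` a
knot whose piece function on a parameter interval `S = [s₁, s₂]` (inside the fundamental domain
`[a, a + 1)`, away from the seam) is the band image `band ∘ P₀` of a planar track. A smooth
family of planar tracks `P u`, `u ∈ [0, 1]`, which agrees with `P₀` off an inner interval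
`(s₁', s₂') ⊂ S` and at `u = 0`, stays in the square neighbourhood, is regular and injective on
`S`, and whose band image avoids the rest of the knot, defines a family of modifications of `k`
(`Knot.IsModification`, `KnotFamilyAmbientIsotopy.lean`) — the band is an injective immersion of
the square neighbourhood — hence an ambient isotopy from `k` to the knot with planar track `P 1`
(`BandData.PlanarFamily.isIsotopic_outKnot`, with the pointwise description of the end knot).

Everything is proved; no named facts are introduced.

## References

* M. W. Hirsch, *Differential Topology*, GTM 33, Springer (1976), Ch. 8 §1, Thm. 1.3.
  [HirschDT1976]
-/

open scoped Manifold ContDiff Topology Real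
open Function Set Metric Filter

noncomputable section

namespace Literature.Topology.FourManifolds

/-- Local notation: `𝔼 n` is the model Euclidean space `EuclideanSpace ℝ (Fin n)`. -/
local notation "𝔼 " n:arg => EuclideanSpace ℝ (Fin n)

/-- Local notation: `𝕊 n` is the unit sphere in `EuclideanSpace ℝ (Fin (n + 1))`. -/
local notation "𝕊 " n:arg => (Metric.sphere (0 : EuclideanSpace ℝ (Fin (n + 1))) 1)

attribute [local instance] fact_finrank_euclideanSpace_succ

namespace BandData

variable {A B K : Knot} {avoid : Set (𝕊 3)} (b : BandData A B K avoid)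

/-- **A planar family in the band** for the knot `k`: tracks `P u : ℝ → ℝ²` (`u ∈ [0, 1]`) moving
the piece of `k` over `S = [s₁, s₂]` inside the band. [folklore] -/
structure PlanarFamily (k : Knot) (a ε s₁ s₁' s₂' s₂ : ℝ) (P : ℝ → ℝ → 𝔼 2) : Prop where
  ε_pos : 0 < ε
  hs : a + ε ≤ s₁ ∧ s₁ < s₁' ∧ s₁' < s₂' ∧ s₂' < s₂ ∧ s₂ ≤ a + 1 - ε
  contDiff : ContDiff ℝ ∞ (uncurry P)
  /-- Off the inner interval nothing moves. -/
  eq_zero : ∀ u t, t ∉ Ioo s₁' s₂' → P u t = P 0 t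
  /-- On `S` the knot is the band image of the initial track. -/
  curve_eq : ∀ s ∈ Icc s₁ s₂, Knot.curve k s = ((b.band (P 0 s) : 𝕊 3) : 𝔼 4)
  /-- The tracks stay in the square neighbourhood. -/
  mem : ∀ u ∈ Icc (0 : ℝ) 1, ∀ s ∈ Icc s₁ s₂, P u s ∈ squareNhd b.δ
  /-- The tracks are regular. -/
  deriv_ne : ∀ u ∈ Icc (0 : ℝ) 1, ∀ s ∈ Icc s₁ s₂, deriv (P u) s ≠ 0
  /-- The tracks are injective. -/
  injOn : ∀ u ∈ Icc (0 : ℝ) 1, InjOn (P u) (Icc s₁ s₂)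
  /-- The band images of the tracks avoid the rest of the knot. -/
  disjoint : ∀ u ∈ Icc (0 : ℝ) 1, ∀ s ∈ Icc s₁ s₂, ∀ t ∈ Ico a (a + 1), t ∉ Icc s₁ s₂ →
    ((b.band (P u s) : 𝕊 3) : 𝔼 4) ≠ Knot.curve k t

namespace PlanarFamily

variable {b} {k : Knot} {a ε s₁ s₁' s₂' s₂ : ℝ} {P : ℝ → ℝ → 𝔼 2} (h : b.PlanarFamily k a ε s₁ s₁' s₂' s₂ P)
include h

/-- **The family of piece functions**: the curve of `k` plus the band displacement
`band (P u t) - band (P 0 t)` (which vanishes off the inner interval). [folklore] -/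
def fam (_ : b.PlanarFamily k a ε s₁ s₁' s₂' s₂ P) (u t : ℝ) : 𝔼 4 :=
  Knot.curve k t + (((b.band (P u t) : 𝕊 3) : 𝔼 4) - ((b.band (P 0 t) : 𝕊 3) : 𝔼 4))

/-- Off the inner interval the family is the curve of `k`. [folklore] -/
theorem fam_of_not_mem (u : ℝ) {t : ℝ} (ht : t ∉ Ioo s₁' s₂') : h.fam u t = Knot.curve k t := by
  rw [fam, h.eq_zero u t ht, sub_self, add_zero]

/-- On `S` the family is the band image of the track. [folklore] -/
theorem fam_of_mem (u : ℝ) {s : ℝ} (hs : s ∈ Icc s₁ s₂) : h.fam u s = ((b.band (P u s) : 𝕊 3) : 𝔼 4) := by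
  rw [fam, h.curve_eq s hs]; abel

/-- At `u = 0` the family is the curve of `k`. [folklore] -/
theorem fam_zero (t : ℝ) : h.fam 0 t = Knot.curve k t := by
  rw [fam, sub_self, add_zero]

/-- The family is jointly `C^∞`. [folklore] -/
theorem contDiff_fam : ContDiff ℝ ∞ (uncurry h.fam) := by
  have h1 : ContDiff ℝ ∞ fun p : ℝ × ℝ ↦ Knot.curve k p.2 := k.contDiff_curve.comp contDiff_snd
  have h2 : ContDiff ℝ ∞ fun p : ℝ × ℝ ↦ ((b.band (P p.1 p.2) : 𝕊 3) : 𝔼 4) := b.contDiff_coe_band.comp h.contDiff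
  have h3 : ContDiff ℝ ∞ fun p : ℝ × ℝ ↦ ((b.band (P 0 p.2) : 𝕊 3) : 𝔼 4) :=
    b.contDiff_coe_band.comp (h.contDiff.comp (contDiff_const.prodMk contDiff_snd))
  exact h1.add (h2.sub h3)

/-- Each track is `C^∞`. [folklore] -/
theorem contDiff_track (u : ℝ) : ContDiff ℝ ∞ (P u) := h.contDiff.comp (contDiff_const.prodMk contDiff_id)

/-- **The family is regular on `S`.** [folklore] -/
theorem deriv_fam_ne_zero {u : ℝ} (hu : u ∈ Icc (0 : ℝ) 1) {s : ℝ} (hs : s ∈ Icc s₁ s₂) : deriv (h.fam u) s ≠ 0 := by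
  obtain ⟨_, h12, _, h34, _⟩ := h.hs
  by_cases hin : s ∈ Ioo s₁ s₂
  · -- inside: the family is the band image of the track near `s`
    have hev : h.fam u =ᶠ[𝓝 s] fun s ↦ ((b.band (P u s) : 𝕊 3) : 𝔼 4) := by
      filter_upwards [Ioo_mem_nhds hin.1 hin.2] with s' hs' using h.fam_of_mem u (Ioo_subset_Icc_self hs')
    rw [hev.deriv_eq]
    exact b.deriv_coe_band_comp_ne_zero (((h.contDiff_track u).differentiable (by simp)) s) (h.mem u hu s hs) (h.deriv_ne u hu s hs)
  · -- at the end points: the family is the curve of `k` near `s`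
    have hs' : s = s₁ ∨ s = s₂ := by
      rcases eq_or_lt_of_le hs.1 with h1 | h1
      · exact Or.inl h1.symm
      rcases eq_or_lt_of_le hs.2 with h2 | h2
      · exact Or.inr h2
      exact absurd ⟨h1, h2⟩ hin
    have hev : h.fam u =ᶠ[𝓝 s] Knot.curve k := by
      rcases hs' with rfl | rfl
      · filter_upwards [Iio_mem_nhds h12] with s' hs' using h.fam_of_not_mem u (fun hh ↦ absurd hh.1 (not_lt.2 hs'.le))
      · filter_upwards [Ioi_mem_nhds h34] with s' hs' using h.fam_of_not_mem u (fun hh ↦ absurd hh.2 (not_lt.2 hs'.le))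
    rw [hev.deriv_eq]; exact k.deriv_curve_ne_zero s

/-- **The family of modifications of `k`.** [folklore] -/
theorem isModification : k.IsModification a ε h.fam (Icc s₁ s₂) where
  ε_pos := h.ε_pos
  contDiff := h.contDiff_fam
  subset := Icc_subset_Icc h.hs.1 h.hs.2.2.2.2
  isClosed := isClosed_Icc
  eq_curve u t ht := h.fam_of_not_mem u (fun hh ↦ ht ⟨(h.hs.2.1.trans hh.1).le, (hh.2.trans h.hs.2.2.2.1).le⟩)
  zero_eq := h.fam_zero
  norm_eq_one u _ s hs := by rw [h.fam_of_mem u hs]; exact norm_eq_of_mem_sphere _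
  deriv_ne_zero _ hu _ hs := h.deriv_fam_ne_zero hu hs
  injOn u hu s hs s' hs' he := by
    rw [h.fam_of_mem u hs, h.fam_of_mem u hs'] at he
    exact h.injOn u hu hs hs' (b.injOn (h.mem u hu s hs) (h.mem u hu s' hs') (Subtype.ext he))
  disjoint u hu s hs t ht hts := by rw [h.fam_of_mem u hs]; exact h.disjoint u hu s hs t ht hts

/-- **The end knot** of the planar family. [folklore] -/
def outKnot : Knot := h.isModification.knotAt 1

/-- **The knot is isotopic to the end knot of a planar family in the band.**
[cite: HirschDT1976, Ch. 8 §1, Thm. 1.3] -/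
theorem isIsotopic_outKnot : k.IsIsotopic h.outKnot := by
  obtain ⟨Θ, -, hΘ, -⟩ := h.isModification.exists_ambientIsotopy isOpen_univ (fun y hy ↦ absurd (mem_univ y) hy)
  exact ⟨Θ, hΘ 1 ⟨zero_le_one, le_rfl⟩⟩

/-- **The end knot on `S`** is the band image of the final track. [folklore] -/
theorem outKnot_circlePt_of_mem {s : ℝ} (hs : s ∈ Icc s₁ s₂) : h.outKnot (circlePt s) = b.band (P 1 s) := by
  apply Subtype.ext
  rw [outKnot, h.isModification.coe_knotAt_circlePt_of_mem 1 hs, Real.smoothTransition.one, h.fam_of_mem 1 hs]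

/-- **The end knot off `S`** is the old knot. [folklore] -/
theorem outKnot_circlePt_of_not_mem {t : ℝ} (ht : t ∈ Ico a (a + 1)) (hts : t ∉ Icc s₁ s₂) :
    h.outKnot (circlePt t) = k (circlePt t) := by
  rw [outKnot, h.isModification.knotAt_apply_of_forall_not_mem 1 (fun s hs he ↦ ?_)]
  obtain ⟨m, hm⟩ := circlePt_eq_circlePt_iff.1 he
  have hsI : s ∈ Ico a (a + 1) := ⟨by linarith [hs.1, h.hs.1, h.ε_pos], by linarith [hs.2, h.hs.2.2.2.2, h.ε_pos]⟩
  have h1 : (m : ℝ) < 1 := by linarith [hsI.2, ht.1]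
  have h2 : (-1 : ℝ) < m := by linarith [hsI.1, ht.2]
  have h1' : m < 1 := by exact_mod_cast h1
  have h2' : -1 < m := by exact_mod_cast h2
  obtain rfl : m = 0 := by omega
  simp only [Int.cast_zero, add_zero] at hm
  exact hts (hm ▸ hs)

/-- The end knot through `circlePt` on the whole fundamental domain, read in `ℝ⁴`. [folklore] -/
theorem coe_outKnot_circlePt {t : ℝ} (ht : t ∈ Ico a (a + 1)) :
    ((h.outKnot (circlePt t) : 𝕊 3) : 𝔼 4) = h.fam 1 t := by
  by_cases hts : t ∈ Icc s₁ s₂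
  · rw [h.outKnot_circlePt_of_mem hts, h.fam_of_mem 1 hts]
  · rw [h.outKnot_circlePt_of_not_mem ht hts, ← Knot.curve_apply,
      h.fam_of_not_mem 1 (fun hh ↦ hts ⟨(h.hs.2.1.trans hh.1).le, (hh.2.trans h.hs.2.2.2.1).le⟩)]

end PlanarFamily

end BandData

end Literature.Topology.FourManifolds
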